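import Literature.AlgebraicGeometry.GroupSchemes.CartierDualAnnihilatorFunctorial
import Literature.AlgebraicGeometry.GroupSchemes.CartierDualAnnihilatorRank
import HarnessLib

/-!
# The annihilator `C^⊥ ⊂ G′` under an abstract perfect duality `e : G′ ≅ G^D`: closed subgroup, points, rank, stability, antitonicity
# (Tate 1997 §(3.8); Mumford AV §20 ∕ §23 «`e_λ`-orthogonal»)

Layer `Literature/AlgebraicGeometry/GroupSchemes`, namespace `Literature.AlgebraicGeometry.GroupSchemes.AffineGroupScheme` (continues ★
`CartierDualAnnihilator` p845459 — `annihilator j = H^⊥ := Ker (j^D) ⊂ G^D`, `annihilatorι`, `exists_eq_comp_annihilatorι_iff` —, ★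
`CartierDualAnnihilatorFunctorial` p845551 — stability ∕ antitonicity of `H^⊥` —, ★ `CartierDualAnnihilatorRank` p845797 — `rk H^⊥ · rk H = rk G`).
THEOREMS ONLY (no definition, no instance, no notation, no named fact, no `sorry`).  Cell `hodgecm-mathlib` (D-0151), programme P6 «MOD», HEART organ
ST-0′ row **(g3-b)** (A-p17 (g24) CENSUS-ST0 «(g3) ST-0 proper over an abstract duality hypothesis»; LEAD F0P6-plan (g0) M-16 (6); B-p04 (g37)
17:06:55Z «your (g3-b) inputs are all in the tree»; A-p06 (g30)).  Count-neutral Mathlib-side capital: HC_CM is proved only modulo the 7 printed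
citations until rung 0 closes; nothing here bears on it.

THE SHAPE.  The HEART's `C^⊥ ⊂ 𝒜_t[w̄][ϖ̄]` is the annihilator of an admissible `C ⊂ 𝒜_t[w][ϖ]` under the `λ`-Weil pairing; the scheme-level
pairing `𝒜_t[w̄][ϖ̄] ≅ (𝒜_t[w][ϖ])^D` ((g2), [MumfordAV1970] §15 Thm. 1 ∕ [Oda1969]) is not in the tree, so this file takes the duality as an ABSTRACT
isomorphism of group schemes `e : G′ ≅ G^D` (`[IsMonHom e.hom]`) and reads `C^⊥ ⊂ G′` as the closed subgroup
`annihilatorι j ≫ e.inv : annihilator j ⟶ G′` (`j : C ⟶ G`).  Then, for finite free commutative group schemes over `R` (rank statements over a field):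

* §1 `C^⊥ ↪ G′` is a homomorphism, a monomorphism and a CLOSED IMMERSION (`isClosedImmersion_annihilatorι_comp_inv_left`);
* §2 points: a `T`-point `x` of `G′` factors through `C^⊥` iff the character `e(x)` of `G` is trivial on `C`
  (`exists_eq_comp_annihilatorι_comp_inv_iff`, ★ `exists_eq_comp_annihilatorι_iff`) — «`C` and `C^⊥` pair trivially»;
* §3 RANK over a field: `finrank_alg_eq_of_iso` (`rk Γ(G′) = rk Γ(G^D)` along `e`), **`finrank_alg_annihilator_mul_finrank_eq_of_iso :
  rk Γ(C^⊥) · rk Γ(C) = rk Γ(G′)`** (★ `finrank_alg_annihilator_mul_finrank` + ★ `finrank_alg_cartierDual`), and the HEART's numerology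
  **`finrank_alg_annihilator_eq_of_finrank_alg_eq_mul`**: `rk Γ(G) = r · rk Γ(C) ⟹ rk Γ(C^⊥) = r` (`rk 𝒢_t[ϖ] = q²`, `rk C = q` ⟹ `rk C^⊥ = q`);
* §4 STABILITY under intertwined endomorphisms: if `e` intertwines `β′ : G′ → G′` with `β^D` (`β′ ≫ e.hom = e.hom ≫ β^D` — for the HEART:
  `β′ = ι′(a)`, `β = ι(ā)`, adjointness of the `𝒪_F`-action under `e_λ`) and `C` is `β`-stable, then `C^⊥` is `β′`-stable
  (**`exists_comp_eq_comp_of_stable_of_intertwines`**, ★ `exists_comp_annihilatorι_eq_of_stable`);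
* §5 ANTITONICITY: `C₁ ≤ C₂ ⟹ C₂^⊥ ≤ C₁^⊥` inside `G′` (**`annihilatorMapOfLE_comp_annihilatorι_comp_inv`**, ★ `annihilatorMapOfLE`).

NOT here: the double annihilator `(C^⊥)^⊥ = C` ((g3-c), needs naturality of the bidual ★ `cartierDualBidualIso`); base change of `C^⊥` (★ p845581
`CartierDualBaseChange` + ★ `GroupSchemeKernelBaseChange`, to be assembled with the desk's `Defs` wording).

## References
* [Tate1997FiniteFlatGroupSchemes] J. Tate, *Finite flat group schemes*, in: Modular Forms and Fermat's Last Theorem (1997), §(3.8) pp. 144–146.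
* [MumfordAV1970] D. Mumford, *Abelian Varieties* (1970), §15 Thm. 1 (p. 143), §20 (Riemann form ∕ `e_λ`), §23.
* [GortzWedhorn2020] U. Görtz, T. Wedhorn, *Algebraic Geometry I: Schemes*, 2nd ed. (2020), (4.15) Definition 4.45, p. 117.
-/

set_option autoImplicit false

-- Mathlib's `Over`/`Scheme` APIs are stated across semireducible wrappers (as in the ★ `GroupSchemes/*` files).
set_option backward.isDefEq.respectTransparency false

universe u

open CategoryTheory CategoryTheory.Limits AlgebraicGeometry MonoidalCategory CartesianMonoidalCategory WithConv

noncomputable section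

namespace Literature.AlgebraicGeometry.GroupSchemes

namespace AffineGroupScheme

open scoped MonObj

open Literature.AlgebraicGeometry.Motives Literature.NumberTheory.DiophantineGeometry Literature.RingTheory.HopfAlgebra GroupSchemeKernel

section General

variable {R : Type u} [CommRing R] {H G G' : SchemeOver R}
  [GrpObj H] [IsCommMonObj H] [IsAffine H.left] [Module.Free R (Alg H)] [Module.Finite R (Alg H)]
  [GrpObj G] [IsCommMonObj G] [IsAffine G.left]
  (j : H ⟶ G) [IsMonHom j] (e : G' ≅ cartierDual G)

/-! ## §1 `C^⊥ := ι ≫ e⁻¹ : annihilator j ⟶ G′` is a closed subgroup -/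

/-- `C^⊥ ↪ G′` is a homomorphism (`ι` is, and the inverse of the homomorphic isomorphism `e` is). [cite: GortzWedhorn2020, Definition 4.45 (2), p. 117] -/
theorem isMonHom_annihilatorι_comp_inv [Module.Free R (Alg G)] [Module.Finite R (Alg G)] [GrpObj G'] [IsMonHom e.hom] :
    IsMonHom (annihilatorι j ≫ e.inv) := inferInstance

/-- `C^⊥ ↪ G′` is a monomorphism. [cite: GortzWedhorn2020, Definition 4.45 (2), p. 117] -/
theorem mono_annihilatorι_comp_inv : Mono (annihilatorι j ≫ e.inv) := by
  haveI := mono_annihilatorι j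
  exact mono_comp _ _

/-- **`C^⊥ ↪ G′` is a CLOSED IMMERSION** — `C^⊥` is a closed subgroup scheme of `G′` (★ `isClosedImmersion_annihilatorι_left` followed by the
isomorphism `e⁻¹`). [cite: GortzWedhorn2020, Definition 4.45 (2), p. 117] [cite: Tate1997FiniteFlatGroupSchemes, §(3.8) p. 146] -/
theorem isClosedImmersion_annihilatorι_comp_inv_left : IsClosedImmersion (annihilatorι j ≫ e.inv).left := by
  haveI := isClosedImmersion_annihilatorι_left j
  rw [Over.comp_left]
  infer_instance

/-! ## §2 Points of `C^⊥ ⊂ G′`: `e(x)` is a character of `G` trivial on `C` -/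

variable {T : SchemeOver R}

/-- A `T`-point of `G′` factors through `C^⊥ ↪ G′` iff `e` of it factors through `ι : C^⊥ ↪ G^D`. [cite: Tate1997FiniteFlatGroupSchemes, §(3.8) p. 146] -/
theorem exists_eq_comp_annihilatorι_comp_inv_iff_exists (x : T ⟶ G') :
    (∃ c : T ⟶ annihilator j, c ≫ (annihilatorι j ≫ e.inv) = x) ↔ ∃ c : T ⟶ annihilator j, c ≫ annihilatorι j = x ≫ e.hom := by
  refine exists_congr fun c => ?_
  rw [← Category.assoc, Iso.comp_inv_eq]

/-- **A `T`-point `x` of `G′` lies in `C^⊥` iff the character `e(x)` of `G` is TRIVIAL ON `C`** (`coord (x ≫ e) ∘ (Γ(j))^*` is the convolution unit;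
★ `exists_eq_comp_annihilatorι_iff`) — «`C` and `C^⊥` pair trivially under `e`». [cite: Tate1997FiniteFlatGroupSchemes, §(3.8) p. 146] -/
theorem exists_eq_comp_annihilatorι_comp_inv_iff (x : T ⟶ G') :
    (∃ c : T ⟶ annihilator j, c ≫ (annihilatorι j ≫ e.inv) = x) ↔
      (coord (x ≫ e.hom)).comp (DualAlg.transpose j) = (1 : WithConv (DualAlg H →ₐ[R] Alg T)).ofConv := by
  rw [exists_eq_comp_annihilatorι_comp_inv_iff_exists, exists_eq_comp_annihilatorι_iff]

/-! ## §4 Stability: `e` intertwines `β′` with `β^D` and `C` is `β`-stable ⟹ `C^⊥` is `β′`-stable -/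

omit [GrpObj H] [IsCommMonObj H] [IsAffine H.left] [Module.Free R (Alg H)] [Module.Finite R (Alg H)] [IsMonHom j] in
/-- `β′ ≫ e = e ≫ β^D ⟹ β^D ≫ e⁻¹ = e⁻¹ ≫ β′`. [cite: Tate1997FiniteFlatGroupSchemes, §(3.8) p. 145] -/
theorem cartierDualMap_comp_inv_eq_of_intertwines (β : G ⟶ G) [IsMonHom β] (β' : G' ⟶ G')
    (hββ' : β' ≫ e.hom = e.hom ≫ cartierDualMap β) : cartierDualMap β ≫ e.inv = e.inv ≫ β' := by
  rw [Iso.comp_inv_eq, Category.assoc, Iso.eq_inv_comp, hββ']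

/-- **STABILITY OF `C^⊥` UNDER INTERTWINED ENDOMORPHISMS.** Let `β : G → G`, `β′ : G′ → G′` be endomorphisms with `e` intertwining `β′` and the
dual of `β` (`β′ ≫ e = e ≫ β^D`; HEART: `β′ = ι′(a)`, `β = ι(ā)`, the adjointness of the `𝒪_F`-action under `e_λ`), and let `C` (`j : C → G`) be
`β`-stable (`t ≫ j = j ≫ β`).  Then `C^⊥ ⊂ G′` is `β′`-stable: there is a homomorphism `t′ : C^⊥ → C^⊥` with `t′ ≫ (ι ≫ e⁻¹) = (ι ≫ e⁻¹) ≫ β′`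
(★ `exists_comp_annihilatorι_eq_of_stable`). [cite: Tate1997FiniteFlatGroupSchemes, §(3.8) p. 146] [cite: MumfordAV1970, §20 (pp. 189–190)] -/
theorem exists_comp_eq_comp_of_stable_of_intertwines [Module.Free R (Alg G)] [Module.Finite R (Alg G)] (β : G ⟶ G) [IsMonHom β]
    (β' : G' ⟶ G')
    (hββ' : β' ≫ e.hom = e.hom ≫ cartierDualMap β) (t : H ⟶ H) [IsMonHom t] (h : t ≫ j = j ≫ β) :
    ∃ t' : annihilator j ⟶ annihilator j, IsMonHom t' ∧ t' ≫ (annihilatorι j ≫ e.inv) = (annihilatorι j ≫ e.inv) ≫ β' := by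
  obtain ⟨t', ht', hc⟩ := exists_comp_annihilatorι_eq_of_stable j β t h
  refine ⟨t', ht', ?_⟩
  rw [← Category.assoc, hc, Category.assoc, cartierDualMap_comp_inv_eq_of_intertwines e β β' hββ', Category.assoc]

end General

/-! ## §5 Antitonicity: `C₁ ≤ C₂ ⟹ C₂^⊥ ≤ C₁^⊥` inside `G′` -/

section Antitone

variable {R : Type u} [CommRing R] {H₁ H₂ G G' : SchemeOver R}
  [GrpObj H₁] [IsCommMonObj H₁] [IsAffine H₁.left] [Module.Free R (Alg H₁)] [Module.Finite R (Alg H₁)]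
  [GrpObj H₂] [IsCommMonObj H₂] [IsAffine H₂.left] [Module.Free R (Alg H₂)] [Module.Finite R (Alg H₂)]
  [GrpObj G] [IsCommMonObj G] [IsAffine G.left]
  (i₁ : H₁ ⟶ G) [IsMonHom i₁] (i₂ : H₂ ⟶ G) [IsMonHom i₂] (t : H₁ ⟶ H₂) [IsMonHom t] (h : t ≫ i₂ = i₁) (e : G' ≅ cartierDual G)

/-- **`C₁ ≤ C₂ ⟹ C₂^⊥ ≤ C₁^⊥` inside `G′`**: the ★ map `annihilatorMapOfLE : C₂^⊥ → C₁^⊥` (a homomorphism and a closed immersion) commutes with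
the embeddings `ι ≫ e⁻¹` into `G′`. [cite: Tate1997FiniteFlatGroupSchemes, §(3.8) p. 146] -/
theorem annihilatorMapOfLE_comp_annihilatorι_comp_inv :
    annihilatorMapOfLE i₁ i₂ t h ≫ (annihilatorι i₁ ≫ e.inv) = annihilatorι i₂ ≫ e.inv := by
  rw [← Category.assoc, annihilatorMapOfLE_comp_ι]

include t h in
/-- Factorisation form: `C₁ ≤ C₂ ⟹ ∃ u : C₂^⊥ → C₁^⊥`, a homomorphism and a closed immersion, over `G′`. [cite: Tate1997FiniteFlatGroupSchemes, §(3.8) p. 146] -/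
theorem exists_comp_eq_annihilatorι_comp_inv_of_le [Module.Free R (Alg G)] [Module.Finite R (Alg G)] :
    ∃ u : annihilator i₂ ⟶ annihilator i₁,
      IsMonHom u ∧ IsClosedImmersion u.left ∧ u ≫ (annihilatorι i₁ ≫ e.inv) = annihilatorι i₂ ≫ e.inv :=
  ⟨annihilatorMapOfLE i₁ i₂ t h, isMonHom_annihilatorMapOfLE i₁ i₂ t h, isClosedImmersion_annihilatorMapOfLE_left i₁ i₂ t h,
    annihilatorMapOfLE_comp_annihilatorι_comp_inv i₁ i₂ t h e⟩

end Antitone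

/-! ## §3 Rank over a field: `rk C^⊥ · rk C = rk G′`; `rk G = r · rk C ⟹ rk C^⊥ = r` -/

section Field

variable {k : Type u} [Field k] {H G G' : SchemeOver k}
  [GrpObj H] [IsCommMonObj H] [IsAffine H.left] [Module.Finite k (Alg H)]
  [GrpObj G] [IsCommMonObj G] [IsAffine G.left] [Module.Finite k (Alg G)]
  (j : H ⟶ G) [IsMonHom j] [IsClosedImmersion j.left] (e : G' ≅ cartierDual G)

omit [GrpObj H] [IsCommMonObj H] [IsAffine H.left] [Module.Finite k (Alg H)] [Module.Finite k (Alg G)] in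
include e in
/-- **`rk Γ(G′) = rk Γ(G^D)` along the isomorphism `e`** (`Γ` is a functor: `Γ(e) ∘ Γ(e⁻¹) = id`, ★ `Alg.comap_comp ∕ _id`).
[cite: Tate1997FiniteFlatGroupSchemes, §(3.8) p. 145] -/
theorem finrank_alg_eq_of_iso : Module.finrank k (Alg G') = Module.finrank k (Alg (cartierDual G)) := by
  refine LinearEquiv.finrank_eq (AlgEquiv.ofAlgHom (Alg.comap e.inv) (Alg.comap e.hom) ?_ ?_).toLinearEquiv
  · rw [← Alg.comap_comp, Iso.inv_hom_id, Alg.comap_id]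
  · rw [← Alg.comap_comp, Iso.hom_inv_id, Alg.comap_id]

include e in
/-- **THE RANK CLAUSE through the duality: `rk Γ(C^⊥) · rk Γ(C) = rk Γ(G′)`** (★ `finrank_alg_annihilator_mul_finrank` + ★ `finrank_alg_cartierDual`
+ §3 `finrank_alg_eq_of_iso`). [cite: Tate1997FiniteFlatGroupSchemes, §(3.8) p. 145] -/
theorem finrank_alg_annihilator_mul_finrank_eq_of_iso :
    Module.finrank k (Alg (annihilator j)) * Module.finrank k (Alg H) = Module.finrank k (Alg G') := by
  rw [finrank_alg_eq_of_iso e, finrank_alg_cartierDual, finrank_alg_annihilator_mul_finrank j]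

/-- **The HEART's numerology: `rk Γ(G) = r · rk Γ(C) ⟹ rk Γ(C^⊥) = r`** (e.g. `rk 𝒢_t[ϖ] = q²`, `rk C = q` ⟹ `rk C^⊥ = q`; ★ rank clause and
`rk Γ(C) > 0`, ★ `finrank_alg_pos`). [cite: Tate1997FiniteFlatGroupSchemes, §(3.8) p. 145] -/
theorem finrank_alg_annihilator_eq_of_finrank_alg_eq_mul {r : ℕ} (hr : Module.finrank k (Alg G) = r * Module.finrank k (Alg H)) :
    Module.finrank k (Alg (annihilator j)) = r := by
  have h := finrank_alg_annihilator_mul_finrank j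
  rw [hr] at h
  exact Nat.eq_of_mul_eq_mul_right (finrank_alg_pos (H := H)) h

end Field

end AffineGroupScheme

end Literature.AlgebraicGeometry.GroupSchemes

end
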